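import Literature.MathematicalPhysics.QuantumLattice.KomaTasakiTower

/-!
# Koma–Tasaki 1994, Theorem 2.4: the state `Φ`, Cauchy–Schwarz bounds and Lemma `easyLemma` (`b_m`)

Towards the proof of the named fact `theorem_2_4` of `KomaTasakiSSB.lean` (T. Koma, H. Tasaki,
J. Stat. Phys. **76** (1994) 745–803, `KomaTasaki1994`, Section 5).

* `TowerState sys Φ μ γ`: the standing hypotheses of Section 5 on the state `Φ` — `‖Φ‖ = 1`,
  `C Φ = 0` (derived from vi) in `KomaTasakiTowerExp`), long-range order (2.17)
  `⟨Φ, (O⁽¹⁾)² Φ⟩ ≥ (μ o N)²` with `0 < μ ≤ 1`, hypothesis v) `[O⁽¹⁾, O⁽²⁾] = iγ C` with `γ > 0`,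
  and `N ≥ 1`;
* the Schwarz-inequality bounds (ABC) of §4, `|ω(A* B C)| ≤ ‖B‖ √(ω(A*A) ω(C*C))`, in vector form;
* **Lemma `easyLemma`** (KT (bmDef), (b/b)): with `c_m = 4^m (m!)²/(2m)! = 4^m / binom(2m, m)` and
  `b_m = c_m ω((O⁽¹⁾)^{2m})`, `0 < b_m` and `1/(2 (oN)²) ≤ b_{m-1}/b_m ≤ 1/(μ o N)²`
  (`bm_pos`, `bm_succ_le`, `sq_mul_bm_le_succ`).

Locators: equation labels such as `(bmDef)`, `(K+Lcond)`, `(dBound1)`, `(OBO2)`, `(Bunshi)` and the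
lemma names `easyLemma`/`hardLemma`/`subLemma` (the three lemmas of §5, in this order) are those
of the arXiv source cond-mat/9708132 of `KomaTasaki1994`.

Consumers (2026-08-29): `AndersonTowerOfStatesUnconditional.lean` (KT94 Corollary 2.11 for the Heisenberg antiferromagnet
and hard-core bosons) via `KomaTasakiSSBTowerProofs.lean` (`TowerState.core`, `theorem_2_4_holds`).
-/

noncomputable section

open Complex Finset
open scoped InnerProductSpace ComplexConjugate

namespace Literature.MathematicalPhysics.QuantumLattice.KomaTasaki

universe u v

variable {Λ : Type u} [Fintype Λ] {E : Type v} [NormedAddCommGroup E] [InnerProductSpace ℂ E]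

/-! ### Generic inner-product facts -/

section Generic

omit [Fintype Λ]

/-- Powers of a symmetric operator are symmetric. [folklore] -/
theorem inner_pow_apply_left {T : E →L[ℂ] E} (hT : ∀ x y : E, ⟪T x, y⟫_ℂ = ⟪x, T y⟫_ℂ) (m : ℕ)
    (x y : E) : ⟪(T ^ m) x, y⟫_ℂ = ⟪x, (T ^ m) y⟫_ℂ := by
  induction m generalizing x y with
  | zero => simp
  | succ m ih => rw [pow_succ, mul_apply_eq_comp, ih, hT, ← mul_apply_eq_comp, ← pow_succ', ← pow_succ]

/-- `⟨x, T^{2m} x⟩ = ‖T^m x‖²` for symmetric `T`. [folklore] -/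
theorem inner_pow_two_mul_apply {T : E →L[ℂ] E} (hT : ∀ x y : E, ⟪T x, y⟫_ℂ = ⟪x, T y⟫_ℂ)
    (m : ℕ) (x : E) : ⟪x, (T ^ (2 * m)) x⟫_ℂ = ((‖(T ^ m) x‖ : ℝ) : ℂ) ^ 2 := by
  rw [two_mul, pow_add, mul_apply_eq_comp, ← inner_pow_apply_left hT, inner_self_eq_norm_sq_to_K]
  norm_cast

/-- `re ⟨x, T^{2m} x⟩ = ‖T^m x‖²` for symmetric `T`. [folklore] -/
theorem re_inner_pow_two_mul_apply {T : E →L[ℂ] E} (hT : ∀ x y : E, ⟪T x, y⟫_ℂ = ⟪x, T y⟫_ℂ)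
    (m : ℕ) (x : E) : (⟪x, (T ^ (2 * m)) x⟫_ℂ).re = ‖(T ^ m) x‖ ^ 2 := by
  rw [inner_pow_two_mul_apply hT]; norm_cast

/-- `|⟨x, A B y⟩| ≤ ‖B‖ ‖A† x‖ ‖y‖`-type bound: `|⟨a, B c⟩| ≤ ‖B‖ ‖a‖ ‖c‖`. [folklore] -/
theorem norm_inner_apply_le_opNorm (B : E →L[ℂ] E) (a c : E) : ‖⟪a, B c⟫_ℂ‖ ≤ ‖B‖ * ‖a‖ * ‖c‖ :=
  calc ‖⟪a, B c⟫_ℂ‖ ≤ ‖a‖ * ‖B c‖ := norm_inner_le_norm _ _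
    _ ≤ ‖a‖ * (‖B‖ * ‖c‖) := by gcongr; exact B.le_opNorm c
    _ = ‖B‖ * ‖a‖ * ‖c‖ := by ring

/-- `|⟨x, T^J B T^J x⟩| ≤ ‖B‖ ‖T^J x‖²` for symmetric `T` (KT, proof of (dBound2): "which follows from the
definition of norm"). [cite: KomaTasaki1994, §5 proof of (dBound2)] -/
theorem norm_inner_sandwich_le {T : E →L[ℂ] E} (hT : ∀ x y : E, ⟪T x, y⟫_ℂ = ⟪x, T y⟫_ℂ)
    (B : E →L[ℂ] E) (J : ℕ) (x : E) :
    ‖⟪x, (T ^ J * B * T ^ J) x⟫_ℂ‖ ≤ ‖B‖ * ‖(T ^ J) x‖ ^ 2 := by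
  rw [mul_apply_eq_comp, mul_apply_eq_comp, ← inner_pow_apply_left hT]
  calc ‖⟪(T ^ J) x, B ((T ^ J) x)⟫_ℂ‖ ≤ ‖B‖ * ‖(T ^ J) x‖ * ‖(T ^ J) x‖ := norm_inner_apply_le_opNorm _ _ _
    _ = ‖B‖ * ‖(T ^ J) x‖ ^ 2 := by ring

end Generic

namespace U1System

variable (sys : U1System Λ E)

/-- **Schwarz bound for sandwiched words** (KT §4 (ABC): `|ω(A*BC)| ≤ ‖B‖ √(ω(A*A) ω(C*C))`):
`|⟨Φ, Π_u X Π_v Φ⟩| ≤ ‖X‖ ‖Π_{u†} Φ‖ ‖Π_v Φ‖`. [cite: KomaTasaki1994, §4 (ABC)] -/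
theorem norm_inner_wordOp_mul_mul_wordOp_le (u v : List Bool) (X : E →L[ℂ] E) (Φ : E) :
    ‖⟪Φ, (sys.wordOp u * X * sys.wordOp v) Φ⟫_ℂ‖ ≤
      ‖X‖ * ‖sys.wordOp (wrev u) Φ‖ * ‖sys.wordOp v Φ‖ := by
  rw [mul_apply_eq_comp, mul_apply_eq_comp, inner_wordOp_right]
  exact norm_inner_apply_le_opNorm _ _ _

/-- The crude bound `|⟨Φ, Π_u X Π_v Φ⟩| ≤ ‖X‖ (2 o N)^{|u| + |v|}` for `‖Φ‖ = 1`. [folklore] -/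
theorem norm_inner_wordOp_mul_mul_wordOp_le' (u v : List Bool) (X : E →L[ℂ] E) {Φ : E}
    (hΦ : ‖Φ‖ = 1) :
    ‖⟪Φ, (sys.wordOp u * X * sys.wordOp v) Φ⟫_ℂ‖ ≤ ‖X‖ * (2 * sys.oN) ^ (u.length + v.length) := by
  have hu := sys.norm_wordOp_apply_le (wrev u) Φ
  have hv := sys.norm_wordOp_apply_le v Φ
  rw [hΦ, mul_one, two_mul_obar_mul_card] at hu hv
  rw [length_wrev] at hu
  have h2 : 0 ≤ 2 * sys.oN :=
    mul_nonneg zero_le_two (mul_nonneg sys.obar_pos.le (Nat.cast_nonneg _))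
  calc ‖⟪Φ, (sys.wordOp u * X * sys.wordOp v) Φ⟫_ℂ‖
      ≤ ‖X‖ * ‖sys.wordOp (wrev u) Φ‖ * ‖sys.wordOp v Φ‖ :=
        sys.norm_inner_wordOp_mul_mul_wordOp_le u v X Φ
    _ ≤ ‖X‖ * (2 * sys.oN) ^ u.length * (2 * sys.oN) ^ v.length :=
        mul_le_mul (mul_le_mul_of_nonneg_left hu (norm_nonneg X)) hv (norm_nonneg _)
          (mul_nonneg (norm_nonneg _) (pow_nonneg h2 _))
    _ = ‖X‖ * (2 * sys.oN) ^ (u.length + v.length) := by rw [pow_add]; ring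

end U1System

section Lemma13

/-! ### Lemma `easyLemma` -/

omit [Fintype Λ] in
/-- `c_0 = 1`. [cite: KomaTasaki1994, §5 (bmDef)] -/
@[simp] theorem cCoef_zero : cCoef 0 = 1 := by simp [cCoef]

omit [Fintype Λ] in
/-- `c_m > 0`. [cite: KomaTasaki1994, §5 (bmDef)] -/
theorem cCoef_pos (m : ℕ) : 0 < cCoef m :=
  div_pos (pow_pos four_pos m) (Nat.cast_pos.mpr (Nat.centralBinom_pos m))

omit [Fintype Λ] in
/-- `c_{m+1} (2m+1) = c_m (2m+2)`, i.e. `c_m/c_{m+1} = (2m+1)(2m+2)/(2m+2)² = (2m+1)/(2m+2)`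
(KT, proof of Lemma `easyLemma`). [cite: KomaTasaki1994, §5 proof of Lemma `easyLemma`] -/
theorem cCoef_succ_mul (m : ℕ) : cCoef (m + 1) * (2 * m + 1) = cCoef m * (2 * m + 2) := by
  have h := Nat.succ_mul_centralBinom_succ m
  have h' : ((m : ℝ) + 1) * (Nat.centralBinom (m + 1) : ℝ) = 2 * (2 * m + 1) * Nat.centralBinom m := by
    exact_mod_cast h
  have hcb : (0 : ℝ) < Nat.centralBinom m := by exact_mod_cast Nat.centralBinom_pos m
  have hcb1 : (0 : ℝ) < Nat.centralBinom (m + 1) := by exact_mod_cast Nat.centralBinom_pos (m + 1)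
  unfold cCoef
  rw [div_mul_eq_mul_div, div_mul_eq_mul_div, div_eq_div_iff hcb1.ne' hcb.ne']
  linear_combination (-2 * 4 ^ m) * h'

omit [Fintype Λ] in
/-- `c_m ≤ c_{m+1}`. [cite: KomaTasaki1994, §5 proof of Lemma `easyLemma`] -/
theorem cCoef_le_succ (m : ℕ) : cCoef m ≤ cCoef (m + 1) := by
  have h := cCoef_succ_mul m
  have hp := cCoef_pos m
  nlinarith

omit [Fintype Λ] in
/-- `c_{m+1} ≤ 2 c_m`. [cite: KomaTasaki1994, §5 proof of Lemma `easyLemma`] -/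
theorem cCoef_succ_le (m : ℕ) : cCoef (m + 1) ≤ 2 * cCoef m := by
  have h := cCoef_succ_mul m
  have hp := cCoef_pos m
  have hm : (0 : ℝ) ≤ m := Nat.cast_nonneg m
  nlinarith

/-- `b_m = c_m ‖(O⁽¹⁾)^m Φ‖²`. [cite: KomaTasaki1994, §5 (bmDef)] -/
theorem bm_eq (sys : U1System Λ E) (Φ : E) (m : ℕ) :
    bm sys Φ m = cCoef m * ‖(sys.order 0 ^ m) Φ‖ ^ 2 := by
  rw [bm, re_inner_pow_two_mul_apply (sys.isSymmetric_order 0)]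

/-- The moments `x_k = ‖(O⁽¹⁾)^k Φ‖²` satisfy `x_{k+1}² ≤ x_{k+2} x_k` (Schwarz, KT (OO1)).
[cite: KomaTasaki1994, §5 (OO1)] -/
theorem norm_pow_succ_sq_le (sys : U1System Λ E) (Φ : E) (k : ℕ) :
    (‖(sys.order 0 ^ (k + 1)) Φ‖ ^ 2) ^ 2 ≤
      ‖(sys.order 0 ^ (k + 1 + 1)) Φ‖ ^ 2 * ‖(sys.order 0 ^ k) Φ‖ ^ 2 := by
  have hs : ∀ x y : E, ⟪sys.order 0 x, y⟫_ℂ = ⟪x, sys.order 0 y⟫_ℂ := sys.isSymmetric_order 0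
  have h1 : ⟪(sys.order 0 ^ (k + 1 + 1)) Φ, (sys.order 0 ^ k) Φ⟫_ℂ =
      ⟪(sys.order 0 ^ (k + 1)) Φ, (sys.order 0 ^ (k + 1)) Φ⟫_ℂ := by
    rw [pow_succ' (sys.order 0) (k + 1), mul_apply_eq_comp, hs, ← mul_apply_eq_comp, ← pow_succ']
  have h2 : ‖(sys.order 0 ^ (k + 1)) Φ‖ ^ 2 ≤
      ‖(sys.order 0 ^ (k + 1 + 1)) Φ‖ * ‖(sys.order 0 ^ k) Φ‖ := by
    rw [← @inner_self_eq_norm_sq ℂ, RCLike.re_to_complex, ← h1]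
    exact (Complex.re_le_norm _).trans (norm_inner_le_norm _ _)
  calc (‖(sys.order 0 ^ (k + 1)) Φ‖ ^ 2) ^ 2
      ≤ (‖(sys.order 0 ^ (k + 1 + 1)) Φ‖ * ‖(sys.order 0 ^ k) Φ‖) ^ 2 := by gcongr
    _ = ‖(sys.order 0 ^ (k + 1 + 1)) Φ‖ ^ 2 * ‖(sys.order 0 ^ k) Φ‖ ^ 2 := by ring

/-- `x_{k+1} ≤ (oN)² x_k` (KT (OO2)). [cite: KomaTasaki1994, §5 (OO2)] -/
theorem norm_pow_succ_sq_le' (sys : U1System Λ E) (Φ : E) (k : ℕ) :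
    ‖(sys.order 0 ^ (k + 1)) Φ‖ ^ 2 ≤ sys.oN ^ 2 * ‖(sys.order 0 ^ k) Φ‖ ^ 2 := by
  rw [pow_succ' (sys.order 0) k, mul_apply_eq_comp, ← mul_pow]
  refine pow_le_pow_left₀ (norm_nonneg _) ?_ 2
  exact (ContinuousLinearMap.le_opNorm _ _).trans
    (mul_le_mul_of_nonneg_right (sys.norm_order_le 0) (norm_nonneg _))

/-- **Lemma `easyLemma`, lower ratio bound:** `1/(2 (oN)²) ≤ b_{m-1}/b_m`, i.e. `b_{m+1} ≤ 2 (oN)² b_m`.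
[cite: KomaTasaki1994, §5 Lemma `easyLemma` (b/b)] -/
theorem bm_succ_le (sys : U1System Λ E) (Φ : E) (m : ℕ) :
    bm sys Φ (m + 1) ≤ 2 * sys.oN ^ 2 * bm sys Φ m := by
  rw [bm_eq, bm_eq]
  have h1 := norm_pow_succ_sq_le' sys Φ m
  have h2 := cCoef_succ_le m
  have h3 := (cCoef_pos (m + 1)).le
  calc cCoef (m + 1) * ‖(sys.order 0 ^ (m + 1)) Φ‖ ^ 2
      ≤ (2 * cCoef m) * (sys.oN ^ 2 * ‖(sys.order 0 ^ m) Φ‖ ^ 2) := mul_le_mul h2 h1 (sq_nonneg _) (by linarith)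
    _ = 2 * sys.oN ^ 2 * (cCoef m * ‖(sys.order 0 ^ m) Φ‖ ^ 2) := by ring

end Lemma13

/-! ### Consequences of the standing hypotheses `TowerState` -/

namespace TowerState

variable {sys : U1System Λ E} {Φ : E} {μ γ : ℝ}

/-- The lattice is nonempty. [cite: KomaTasaki1994, §5] -/
theorem nonempty (hT : TowerState sys Φ μ γ) : Nonempty Λ := Fintype.card_pos_iff.mp hT.card_pos

/-- `N > 0` as a real number. [cite: KomaTasaki1994, §5] -/
theorem card_pos_real (hT : TowerState sys Φ μ γ) : (0 : ℝ) < Fintype.card Λ :=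
  Nat.cast_pos.mpr hT.card_pos

/-- `oN > 0`. [cite: KomaTasaki1994, §5] -/
theorem oN_pos (hT : TowerState sys Φ μ γ) : 0 < sys.oN := mul_pos sys.obar_pos hT.card_pos_real

/-- `μ o N > 0`. [cite: KomaTasaki1994, §5] -/
theorem muoN_pos (hT : TowerState sys Φ μ γ) : 0 < μ * sys.oN := mul_pos hT.mu_pos hT.oN_pos

/-- `Φ ≠ 0`. [cite: KomaTasaki1994, §5] -/
theorem ne_zero (hT : TowerState sys Φ μ γ) : Φ ≠ 0 := by
  intro h; have := hT.norm_eq_one; rw [h, norm_zero] at this; exact zero_ne_one this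

/-- `[O⁻, O⁺] = -2γ C` (KT p. 785: "By also using the relation `[O⁻, O⁺] = -2γC`").
[cite: KomaTasaki1994, §5 proof of Theorem 2.4] -/
theorem comm_orderMinus_orderPlus (hT : TowerState sys Φ μ γ) :
    sys.orderMinus * sys.orderPlus - sys.orderPlus * sys.orderMinus = -((2 * (γ : ℂ)) • sys.C) := by
  have e : sys.orderMinus * sys.orderPlus - sys.orderPlus * sys.orderMinus =
      (2 * I) • (sys.order 0 * sys.order 1 - sys.order 1 * sys.order 0) := by
    simp only [U1System.orderMinus, U1System.orderPlus, sub_mul, mul_sub, add_mul, mul_add,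
      smul_mul_assoc, mul_smul_comm, smul_sub]
    module
  rw [e, hT.comm, smul_smul, ← neg_smul]
  congr 1
  ring_nf; rw [I_sq]; ring

/-- The adjacent swap `O⁻O⁺ ↦ O⁺O⁻` inside a word costs `-2γ C`:
`Π_u O⁻ O⁺ Π_v - Π_u O⁺ O⁻ Π_v = -2γ Π_u C Π_v`. [cite: KomaTasaki1994, §5 (D2<)] -/
theorem wordOp_swap (hT : TowerState sys Φ μ γ) (u v : List Bool) :
    sys.wordOp (u ++ false :: true :: v) - sys.wordOp (u ++ true :: false :: v) =
      -((2 * (γ : ℂ)) • (sys.wordOp u * sys.C * sys.wordOp v)) := by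
  simp only [U1System.wordOp_append, U1System.wordOp_cons, U1System.sgnOp_true,
    U1System.sgnOp_false]
  rw [← mul_assoc, ← mul_assoc, ← mul_assoc, ← mul_assoc, ← sub_mul, mul_assoc (sys.wordOp u),
    mul_assoc (sys.wordOp u), ← mul_sub, hT.comm_orderMinus_orderPlus, mul_neg, neg_mul,
    mul_smul_comm, smul_mul_assoc]

/-- Long-range order in the form `‖O⁽¹⁾ Φ‖² ≥ (μ o N)²`. [cite: KomaTasaki1994, (2.17)] -/
theorem sq_le_norm_order_apply_sq (hT : TowerState sys Φ μ γ) :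
    (μ * sys.oN) ^ 2 ≤ ‖sys.order 0 Φ‖ ^ 2 := by
  have h := hT.lro
  have hs : ∀ x y : E, ⟪sys.order 0 x, y⟫_ℂ = ⟪x, sys.order 0 y⟫_ℂ := sys.isSymmetric_order 0
  have h2 : (⟪sys.order 0 Φ, sys.order 0 Φ⟫_ℂ).re = ‖sys.order 0 Φ‖ ^ 2 := by
    rw [← @inner_self_eq_norm_sq ℂ, RCLike.re_to_complex]
  rw [← hs, h2] at h
  calc (μ * sys.oN) ^ 2 = (μ * sys.obar * Fintype.card Λ) ^ 2 := by rw [U1System.oN_def]; ring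
    _ ≤ ‖sys.order 0 Φ‖ ^ 2 := h

/-- `b_0 = 1` for a unit vector. [cite: KomaTasaki1994, §5 (bmDef)] -/
theorem bm_zero (hT : TowerState sys Φ μ γ) : bm sys Φ 0 = 1 := by
  rw [bm_eq, cCoef_zero, pow_zero, one_apply_eq_self, hT.norm_eq_one]; norm_num

/-- `0 < x_k` and `(μ o N)² x_k ≤ x_{k+1}` for all `k` (the induction in the proof of Lemma `easyLemma`).
[cite: KomaTasaki1994, §5 (OO1)] -/
theorem norm_pow_pos_and_step (hT : TowerState sys Φ μ γ) (k : ℕ) :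
    0 < ‖(sys.order 0 ^ k) Φ‖ ^ 2 ∧
      (μ * sys.oN) ^ 2 * ‖(sys.order 0 ^ k) Φ‖ ^ 2 ≤ ‖(sys.order 0 ^ (k + 1)) Φ‖ ^ 2 := by
  induction k with
  | zero =>
      simp only [pow_zero, one_apply_eq_self, hT.norm_eq_one, one_pow, mul_one, zero_add, pow_one]
      exact ⟨one_pos, hT.sq_le_norm_order_apply_sq⟩
  | succ k ih =>
      obtain ⟨hpos, hstep⟩ := ih
      have hμ := pow_pos hT.muoN_pos 2
      have hpos' : 0 < ‖(sys.order 0 ^ (k + 1)) Φ‖ ^ 2 := lt_of_lt_of_le (mul_pos hμ hpos) hstep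
      refine ⟨hpos', ?_⟩
      have hcs := norm_pow_succ_sq_le sys Φ k
      -- `x_{k+1}² ≤ x_{k+2} x_k` and `x_{k+1} ≥ (μoN)² x_k` give `x_{k+2} ≥ (μoN)² x_{k+1}`
      have h3 : (μ * sys.oN) ^ 2 * ‖(sys.order 0 ^ (k + 1)) Φ‖ ^ 2 * ‖(sys.order 0 ^ k) Φ‖ ^ 2 ≤
          ‖(sys.order 0 ^ (k + 1 + 1)) Φ‖ ^ 2 * ‖(sys.order 0 ^ k) Φ‖ ^ 2 := by
        have h4 : 0 ≤ ‖(sys.order 0 ^ (k + 1)) Φ‖ ^ 2 := sq_nonneg _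
        nlinarith
      exact le_of_mul_le_mul_right h3 hpos

/-- **Lemma `easyLemma`, positivity:** `b_m > 0`. [cite: KomaTasaki1994, §5 Lemma `easyLemma`] -/
theorem bm_pos (hT : TowerState sys Φ μ γ) (m : ℕ) : 0 < bm sys Φ m := by
  rw [bm_eq]
  exact mul_pos (cCoef_pos m) (hT.norm_pow_pos_and_step m).1

/-- **Lemma `easyLemma`, upper ratio bound:** `b_{m-1}/b_m ≤ 1/(μ o N)²`, i.e. `(μ o N)² b_m ≤ b_{m+1}`.
[cite: KomaTasaki1994, §5 Lemma `easyLemma` (b/b)] -/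
theorem sq_mul_bm_le_succ (hT : TowerState sys Φ μ γ) (m : ℕ) :
    (μ * sys.oN) ^ 2 * bm sys Φ m ≤ bm sys Φ (m + 1) := by
  rw [bm_eq, bm_eq]
  have h1 := (hT.norm_pow_pos_and_step m).2
  have h2 := cCoef_le_succ m
  have h3 := (cCoef_pos m).le
  have h4 : 0 ≤ ‖(sys.order 0 ^ (m + 1)) Φ‖ ^ 2 := sq_nonneg _
  calc (μ * sys.oN) ^ 2 * (cCoef m * ‖(sys.order 0 ^ m) Φ‖ ^ 2)
      = cCoef m * ((μ * sys.oN) ^ 2 * ‖(sys.order 0 ^ m) Φ‖ ^ 2) := by ring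
    _ ≤ cCoef (m + 1) * ‖(sys.order 0 ^ (m + 1)) Φ‖ ^ 2 := mul_le_mul h2 h1 (by positivity) (h3.trans h2)

/-- Iterated ratio bound: `(μ o N)^{2j} b_m ≤ b_{m+j}`. [cite: KomaTasaki1994, §5 Lemma `easyLemma`] -/
theorem pow_mul_bm_le_add (hT : TowerState sys Φ μ γ) (m j : ℕ) :
    ((μ * sys.oN) ^ 2) ^ j * bm sys Φ m ≤ bm sys Φ (m + j) := by
  induction j with
  | zero => simp
  | succ j ih =>
      calc ((μ * sys.oN) ^ 2) ^ (j + 1) * bm sys Φ m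
          = (μ * sys.oN) ^ 2 * (((μ * sys.oN) ^ 2) ^ j * bm sys Φ m) := by ring
        _ ≤ (μ * sys.oN) ^ 2 * bm sys Φ (m + j) := mul_le_mul_of_nonneg_left ih (sq_nonneg _)
        _ ≤ bm sys Φ (m + j + 1) := hT.sq_mul_bm_le_succ (m + j)

end TowerState

end Literature.MathematicalPhysics.QuantumLattice.KomaTasaki
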